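import Literature.Computability.Complexity.CodeFP
import Literature.Computability.MetaComplexity.RefutationCNF
import HarnessLib

/-!
# The Atserias–Müller gadget: machine form and output length of `G(F) = RREF(F, 13n²)`

Immediate consequences of the polynomial-time computability of the gadget
`G(F) = RREF(F, 13n²)` — the named fact `rrefGadget_polyTime` of `RefutationCNF.lean`,
[Atserias–Müller 2020, Thm 2 and §6] — in the forms consumed by reductions:

* `codeFP_rrefGadget_of` — the fact is literally the typed statement `CodeFP enc enc rrefGadget`
  of `CodeFP.lean`; the bundled-machine form `PolyTimeComputable enc enc rrefGadget` of
  `TimeBounds.lean` is then `(codeFP_rrefGadget_of h).polyTimeComputable`, i.e. the generic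
  `CodeFP.polyTimeComputable` (no separate restatement is kept here);
* `rrefGadget_encode_length_le` — the code of `G(F)` is polynomially bounded in the code of `F`
  (so every bound polynomial / exponential in the size `r` of `G(F)`, as in [AM20, Thm 2 (a)–(b)],
  is one in the input length).

Both take the named fact as the hypothesis `(h : rrefGadget_polyTime)`.

## Status of the discharge (2026-08-15)

The discharge `rrefGadget_polyTime_holds` (with the typed machine `codeFP_rrefGadget`) was
accepted as p46356 (2026-08-15T14:06Z) with target `RefutationCNFProofs.lean`; that target was then
overwritten by p46456 (14:20Z, Garlík's transfer, a different unit racing on the same file name), so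
neither declaration is in the tree any more and this file — which used both — stopped building
(work item `fix:Literature.Computability.MetaComplexity.RefutationCNFPolyTime`). This revision
restores the build by threading the fact as a hypothesis; nothing is weakened (the fact itself,
`RefutationCNF.lean`, is unchanged). When the discharge is re-landed it must go to a NEW file
(e.g. `RefutationCNFPolyTimeProofs.lean`, importing this one), never again to
`RefutationCNFProofs.lean`; the unconditional forms are then
`(codeFP_rrefGadget_of rrefGadget_polyTime_holds).polyTimeComputable` and
`rrefGadget_encode_length_le rrefGadget_polyTime_holds`.

## References

* A. Atserias, M. Müller, *Automating Resolution is NP-hard*, J. ACM 67(5) (2020), Art. 31;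
  arXiv:1904.02991, Thm 2 ("a polynomial-time computable function `G`"), §6 ("`G(F)` has size
  … at most `n^q`").
* S. Arora, B. Barak, *Computational Complexity: A Modern Approach*, CUP 2009, §1.3
  (polynomial-time functions have polynomially bounded output).
-/

namespace Literature.Computability.MetaComplexity

open _root_.Computability Complexity

/-- The named fact `rrefGadget_polyTime` is literally the typed statement
`CodeFP enc enc rrefGadget` of `CodeFP.lean` (same `∃ f ∈ FP, ∀ F, f (enc F) = enc (G F)`);
its bundled-machine form `PolyTimeComputable enc enc rrefGadget` is `CodeFP.polyTimeComputable`
applied to this. [cite: AtseriasMuller2020, Thm 2 (G polynomial-time computable)] -/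
theorem codeFP_rrefGadget_of (h : rrefGadget_polyTime) :
    CodeFP encodingCNF.encode encodingCNF.encode rrefGadget := h

/-- **The code of `G(F)` has length polynomial in the code of `F`**, given the named fact
`rrefGadget_polyTime`: there is a polynomial `p` with `|enc (G F)| ≤ p(|enc F|)` for every CNF `F`
(output length of a polynomial-time function).
[cite: AtseriasMuller2020, §6 (proof of Thm 2: "G(F) has size … at most n^q");
AroraBarak2009, §1.3] -/
theorem rrefGadget_encode_length_le (h : rrefGadget_polyTime) :
    ∃ p : Polynomial ℕ, ∀ F : CNF ℕ,
      (encodingCNF.encode (rrefGadget F)).length ≤ p.eval (encodingCNF.encode F).length := by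
  obtain ⟨f, hf, hfF⟩ := h
  obtain ⟨p, hp⟩ := exists_poly_length_le_of_mem_FP hf
  exact ⟨p, fun F => by rw [← hfF]; exact hp _⟩

end Literature.Computability.MetaComplexity
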